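import Literature.Probability.LatticeModels.PlaneRotatorSAWBound
import Literature.Probability.LatticeModels.LayeredPlaneRotatorFisherWindow
import Literature.Probability.LatticeModels.LayeredPlaneRotatorInterlayerCriterion
import Literature.Probability.LatticeModels.PlaneRotatorLiebNearestNeighbourBound
import Literature.Probability.Percolation.CriticalContinuityProofs
import HarnessLib

/-!
# Fisher's self-avoiding-walk bound for the XY model on `ℤ^d` with the two-spin value `u = I₁/I₀`, and the
# certificate-free weak-interlayer window of the classical layered XY model it yields

Topic `Literature/Probability/LatticeModels`. Theorem-only file (no definition, no named fact, no sorry, no certificate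
hypothesis, no kit). Companion of `PlaneRotatorSAWBound.lean` (the multigraph theorem
`PlaneRotator.twoPoint_le_sum_paths_besselRatio`: `⟨cos(θ_a − θ_c)⟩_J ≤ ∑_{SAW ω : a → c} ∏ u(K_b)`, `u = I₁/I₀`) and
of `LayeredPlaneRotatorFisherWindow.lean` (the same window through Aizenman–Simon + Ising–Fisher with `tanh(βJ∥/2)`):

1. **Word form on `ℤ^d`** (`twoPoint_nn_le_sawSum_besselRatio`): for the nearest-neighbour XY model on a finite
   `Λ ⊂ ℤ^d` (free boundary condition, coupling `K ≥ 0` per bond, tree `nnXYCoupling K d Λ`) and `x₀, x ∈ Λ`,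
   `⟨cos(θ_{x₀} − θ_x)⟩_Λ ≤ ∑_{n<|Λ|} σ(n; x − x₀) u(K)ⁿ`, `σ(n; y) = |sawWordsTo d n y|` (a self-avoiding walk inside
   `Λ` is coded, after translation to the origin, by a self-avoiding step word of `ℤ^d`; the coding is injective).
2. **Fisher's criterion** (`sum_twoPoint_nn_le_sawSum_besselRatio`): `∑_{x∈Λ} ⟨cos(θ_{x₀} − θ_x)⟩_Λ ≤ ∑_{n<|Λ|} σ(n) u(K)ⁿ`;
   with the tree's kernel census of `ℤ²` (`c₁…c₁₀ = 4, …, 44100`, `sum_card_sawWords_two_mul_pow_le`) the planar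
   susceptibility is at most `F(u₀) = S₁₀(u₀)/(1 − 44100 u₀¹⁰)` whenever `u(K) ≤ u₀`, `44100 u₀¹⁰ < 1`
   (`sum_twoPoint_nn_two_le_sawSeries`).
3. **Layered window** (`twoPoint_layered_le_pow_sawSeries_besselRatio`): by Griffiths–Ginibre the in-plane system of a
   layer of the layered XY model on `Λ ⊂ ℤ³` is dominated by the planar model on the projected layer, so Lieb–Rivasseau
   decoupling (`twoPoint_layered_le_pow_interlayer'`) gives, for `β, J∥, J⊥ ≥ 0`, `u(βJ∥) ≤ u₀`, `44100 u₀¹⁰ < 1`,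
   `⟨cos(θ_a − θ_c)⟩_{Λ,β} ≤ (β J⊥ F(u₀))^{|ℓ(a) − ℓ(c)|}` — no Ising model, no Aizenman–Simon halving.
4. **Decimal rows** (Amos `u(x) ≤ x/√(x² + 4)`, exact rational arithmetic): `k_BT = (π/2)J∥`: `J⊥ ≤ J∥/7` ⇒
   `(0.9996)^{|Δℓ|}` (was `J∥/8`); `k_BT = 2J∥`: `J⊥ ≤ (23/50)J∥` (was `9/20`); `k_BT = (5/3)J∥`: `J⊥ ≤ (21/100)J∥`
   (was `19/100`); `k_BT = J∥/log 2`: `J⊥ ≤ J∥/20` (was `J∥/32`). Since `u(K) < tanh(K/2)` every row of the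
   tanh-route is dominated; the method reaches `44100 u(K)¹⁰ < 1`, i.e. `T > 1.367·J∥` (tanh-route: `1.398·J∥`).

Reading (cell `pub/hubbard-tc`, ASSUMPTIONS §0/§1 key K4-a; classical comparison model, context only): the
certificate-free disordered edge of the K4-a window at `T = (π/2)·J∥` moves from `Δ = J⊥/J∥ ≤ 1/8` to `≤ 1/7` (the cell
carries `Δ* = 0.27 ± 0.02` [float]). HONEST FRAMING: finite-volume statements about the CLASSICAL layered XY model,
uniform in the volume; «not ordered across the layers» = geometric decay of the two-point function ACROSS the layers;
nothing in-plane, nothing on the ordered side, no `T_c` object.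

References: M. E. Fisher, Phys. Rev. 162 (1967) 480 [Fisher1967]; E. H. Lieb, Commun. Math. Phys. 77 (1980) 127
[Lieb1980]; D. E. Amos, Math. Comp. 28 (1974) 239 [Amos1974]; N. Madras, G. Slade, *The Self-Avoiding Walk* (1993),
§1.2 and Appendix C [MadrasSlade1993]; J. Ginibre, Comm. Math. Phys. 16 (1970) 310 [Ginibre1970].
-/

noncomputable section

open MeasureTheory Filter Finset
open scoped Topology BigOperators

namespace Literature.Probability.LatticeModels

namespace PlaneRotator

open Literature.Probability.Percolation
open Literature.Barriers.CriticalPhenomena Literature.Barriers.CriticalPhenomena.LongRangeIsing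

variable {d : ℕ} [MeasurableSpace Circle] [BorelSpace Circle]

/-! ### §1 The word form on `ℤ^d`: `⟨cos(θ_{x₀} − θ_x)⟩_Λ ≤ ∑_n σ(n; x − x₀) u(K)ⁿ` -/

omit [MeasurableSpace Circle] [BorelSpace Circle] in
/-- Nearest neighbours of `ℤ^d`: `nnCoupling d x y = 𝟙{x ∼ y}` for the graph `zdGraph d`. [folklore] -/
private theorem nnCoupling_eq_ite_adj'' (x y : Site d) :
    nnCoupling d x y = if (zdGraph d).Adj x y then 1 else 0 := by
  have hadj : (zdGraph d).Adj x y ↔ l1Norm (x - y) = 1 := by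
    rw [zdGraph_adj_iff_norm_holds x y]
    have h : ((l1Norm (x - y) : ℕ) : ℤ) = ∑ i, |x i - y i| := by
      simp only [l1Norm, Nat.cast_sum, Int.natCast_natAbs, Pi.sub_apply]
    rw [← h]
    norm_cast
  unfold nnCoupling
  simp only [hadj]

/-- **Fisher's bound for the nearest-neighbour XY model on a finite `Λ ⊂ ℤ^d`, step-word form.** For `K ≥ 0` and
`x₀, x ∈ Λ` (couplings `nnXYCoupling K d Λ`: `K/2` per ordered nearest-neighbour pair, free boundary condition):
`⟨cos(θ_{x₀} − θ_x)⟩_Λ ≤ ∑_{n < |Λ|} σ(n; x − x₀) · u(K)ⁿ`, `u = I₁/I₀`, where `σ(n; y) = |sawWordsTo d n y|` counts the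
`n`-step self-avoiding walks `0 → y` of `ℤ^d` (a self-avoiding walk inside `Λ` is one of `ℤ^d`). The Ising analogue is
the tree's `isingTwoPoint_free_le_sawSum` (`tanh β` per step).
[cite: Fisher1967, Phys. Rev. 162 (1967) 480 (correlation ≤ self-avoiding-walk generating function); Lieb1980, Theorem 4 (I₁(β)/I₀(β))] -/
theorem twoPoint_nn_le_sawSum_besselRatio {K : ℝ} (hK : 0 ≤ K) (Λ : Finset (Site d)) (x₀ x : Λ) :
    twoPoint (nnXYCoupling K d Λ) x₀ x ≤
      ∑ n ∈ Finset.range (Fintype.card Λ),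
        ((sawWordsTo d n ((x : Site d) - (x₀ : Site d))).card : ℝ) * (besselI 1 K / besselI 0 K) ^ n := by
  classical
  -- the nearest-neighbour graph on `Λ` and Fisher's bound with `u(K)^{|ω|}`
  set G : SimpleGraph Λ := (zdGraph d).comap (fun y : Λ => (y : Site d)) with hG
  have hJ : ∀ p, 0 ≤ nnXYCoupling K d Λ p := fun p =>
    mul_nonneg (by positivity) (nnCoupling_nonneg _ _)
  have hGJ : ∀ y z : Λ, y ≠ z → nnXYCoupling K d Λ (y, z) ≠ 0 → G.Adj y z := by
    intro y z _ h
    rw [hG, SimpleGraph.comap_adj]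
    by_contra hadj
    apply h
    simp only [nnXYCoupling, nnCoupling_eq_ite_adj'', if_neg hadj, mul_zero]
  have hKK : ∀ y z : Λ, G.Adj y z → nnXYCoupling K d Λ (y, z) + nnXYCoupling K d Λ (z, y) = K := by
    intro y z hyz
    rw [hG, SimpleGraph.comap_adj] at hyz
    rw [nnXYCoupling_add_swap, nnCoupling_eq_ite_adj'', if_pos hyz, mul_one]
  set P := (G.finsetWalkLengthLT (Fintype.card Λ) x₀ x).filter (fun ω => ω.IsPath) with hP
  set u : ℝ := besselI 1 K / besselI 0 K with hu
  have hu0 : 0 ≤ u := div_nonneg (besselI_nonneg hK 1) (besselI_nonneg hK 0)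
  have h1 : twoPoint (nnXYCoupling K d Λ) x₀ x ≤ ∑ ω ∈ P, u ^ ω.length :=
    twoPoint_le_sum_paths_pow_besselRatio hJ G hGJ hKK x₀ x
  -- regroup the paths by length
  have hlen : ∀ ω ∈ P, ω.length ∈ Finset.range (Fintype.card Λ) := fun ω hω =>
    Finset.mem_range.2 (SimpleGraph.mem_finsetWalkLengthLT_iff.1 (Finset.mem_filter.1 hω).1)
  have h2 : ∑ ω ∈ P, u ^ ω.length =
      ∑ n ∈ Finset.range (Fintype.card Λ), ((P.filter fun ω => ω.length = n).card : ℝ) * u ^ n := by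
    rw [← Finset.sum_fiberwise_of_maps_to' hlen (fun n => u ^ n)]
    refine Finset.sum_congr rfl fun n _ => ?_
    rw [Finset.sum_const, nsmul_eq_mul]
  rw [h2] at h1
  refine h1.trans (Finset.sum_le_sum fun n _ => mul_le_mul_of_nonneg_right ?_ (pow_nonneg hu0 n))
  -- the paths of length `n` inject into the self-avoiding words of length `n` ending at `x − x₀`
  -- translation to the origin as a graph homomorphism into `ℤ^d`
  let φ : G →g zdGraph d :=
    ⟨fun y => Site.shift (-(x₀ : Site d)) (y : Site d), fun h => (zdGraph_adj_shift_iff _ _ _).2 h⟩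
  have hφ0 : φ x₀ = 0 := add_neg_cancel (x₀ : Site d)
  have hφx : φ x = (x : Site d) - (x₀ : Site d) := (sub_eq_add_neg (x : Site d) (x₀ : Site d)).symm
  have hφinj : Function.Injective φ := fun y z h => by
    apply Subtype.ext
    have h' : Site.shift (-(x₀ : Site d)) (y : Site d) = Site.shift (-(x₀ : Site d)) (z : Site d) := h
    exact (Site.shift (-(x₀ : Site d))).injective h'
  -- the word of length `n` of a walk of length `≥ n`
  have hword : ∀ ω : G.Walk x₀ x, n ≤ ω.length →
      ∃ w : Fin n → Fin d × Bool, ∀ k ≤ n, wordPos w k = φ (ω.getVert k) := by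
    intro ω hn
    obtain ⟨w, hw⟩ := exists_word_of_walk (le_refl (zdGraph d)) ((ω.map φ).copy hφ0 rfl) n
      (by rwa [SimpleGraph.Walk.length_copy, SimpleGraph.Walk.length_map])
    exact ⟨w, fun k hk => by rw [hw k hk, SimpleGraph.Walk.getVert_copy, SimpleGraph.Walk.getVert_map]⟩
  set Pn := P.filter (fun ω => ω.length = n) with hPn
  by_cases hne : Nonempty (Fin n → Fin d × Bool)
  swap
  · -- no word of length `n` exists, hence no path of length `n`
    have hempty : Pn = ∅ := by
      refine Finset.eq_empty_of_forall_notMem fun ω hω => hne ?_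
      obtain ⟨w, -⟩ := hword ω (le_of_eq ((Finset.mem_filter.1 hω).2).symm)
      exact ⟨w⟩
    rw [hempty, Finset.card_empty, Nat.cast_zero]
    exact Nat.cast_nonneg _
  set f : G.Walk x₀ x → (Fin n → Fin d × Bool) := fun ω =>
    if h : n ≤ ω.length then Classical.choose (hword ω h) else hne.some with hf
  have hfspec : ∀ ω : G.Walk x₀ x, ∀ h : n ≤ ω.length, ∀ k ≤ n, wordPos (f ω) k = φ (ω.getVert k) := by
    intro ω h k hk
    rw [hf]; dsimp only; rw [dif_pos h]
    exact Classical.choose_spec (hword ω h) k hk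
  have hmaps : Set.MapsTo f ↑Pn ↑(sawWordsTo d n ((x : Site d) - (x₀ : Site d))) := by
    intro ω hω
    rw [Finset.mem_coe, hPn, Finset.mem_filter, hP, Finset.mem_filter] at hω
    obtain ⟨⟨-, hpath⟩, hωn⟩ := hω
    have hle : n ≤ ω.length := le_of_eq hωn.symm
    rw [Finset.mem_coe, sawWordsTo, Finset.mem_filter, mem_sawWords]
    refine ⟨fun i j hi hj hij => ?_, ?_⟩
    · rw [hfspec ω hle i hi, hfspec ω hle j hj] at hij
      have hij' := hφinj hij
      exact hpath.getVert_injOn (by rw [Set.mem_setOf_eq]; omega) (by rw [Set.mem_setOf_eq]; omega) hij'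
    · rw [hfspec ω hle n le_rfl, ← hωn, SimpleGraph.Walk.getVert_length, hφx]
  have hinj : Set.InjOn f ↑Pn := by
    intro ω hω ω' hω' hff
    rw [Finset.mem_coe, hPn, Finset.mem_filter] at hω hω'
    have hle : n ≤ ω.length := le_of_eq hω.2.symm
    have hle' : n ≤ ω'.length := le_of_eq hω'.2.symm
    have hgv : ∀ k ≤ n, ω.getVert k = ω'.getVert k := fun k hk =>
      hφinj (by rw [← hfspec ω hle k hk, ← hfspec ω' hle' k hk, hff])
    apply SimpleGraph.Walk.support_injective
    refine List.ext_getElem (by rw [SimpleGraph.Walk.length_support, SimpleGraph.Walk.length_support, hω.2, hω'.2])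
      fun i h1 h2 => ?_
    rw [SimpleGraph.Walk.length_support] at h1 h2
    rw [← SimpleGraph.Walk.getVert_eq_support_getElem ω (by omega),
      ← SimpleGraph.Walk.getVert_eq_support_getElem ω' (by omega)]
    exact hgv i (by omega)
  exact_mod_cast Finset.card_le_card_of_injOn f hmaps hinj

/-! ### §2 The susceptibility: `∑_x ⟨cos(θ_{x₀} − θ_x)⟩_Λ ≤ ∑_n σ(n) u(K)ⁿ`; the planar census -/

/-- **Fisher's criterion for the XY model, finite volume**: for `K ≥ 0`, every finite `Λ ⊂ ℤ^d` and `x₀ ∈ Λ`,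
`∑_{x ∈ Λ} ⟨cos(θ_{x₀} − θ_x)⟩_Λ ≤ ∑_{n < |Λ|} σ(n) u(K)ⁿ`, `σ(n) = |sawWords d n|` the number of `n`-step
self-avoiding walks of `ℤ^d`, `u = I₁/I₀`. [cite: Fisher1967, Phys. Rev. 162 (1967) 480 (T_c bounds from self-avoiding walks); MadrasSlade1993, §1.2 (c_n)] -/
theorem sum_twoPoint_nn_le_sawSum_besselRatio {K : ℝ} (hK : 0 ≤ K) (Λ : Finset (Site d)) (x₀ : Λ) :
    ∑ x : Λ, twoPoint (nnXYCoupling K d Λ) x₀ x ≤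
      ∑ n ∈ Finset.range (Fintype.card Λ), ((sawWords d n).card : ℝ) * (besselI 1 K / besselI 0 K) ^ n := by
  classical
  have hu0 : 0 ≤ besselI 1 K / besselI 0 K := div_nonneg (besselI_nonneg hK 1) (besselI_nonneg hK 0)
  calc ∑ x : Λ, twoPoint (nnXYCoupling K d Λ) x₀ x
      ≤ ∑ x : Λ, ∑ n ∈ Finset.range (Fintype.card Λ),
          ((sawWordsTo d n ((x : Site d) - (x₀ : Site d))).card : ℝ) * (besselI 1 K / besselI 0 K) ^ n :=
        Finset.sum_le_sum fun x _ => twoPoint_nn_le_sawSum_besselRatio hK Λ x₀ x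
    _ = ∑ n ∈ Finset.range (Fintype.card Λ),
          (∑ x : Λ, ((sawWordsTo d n ((x : Site d) - (x₀ : Site d))).card : ℝ)) * (besselI 1 K / besselI 0 K) ^ n := by
        rw [Finset.sum_comm]
        refine Finset.sum_congr rfl fun n _ => ?_
        rw [Finset.sum_mul]
    _ ≤ ∑ n ∈ Finset.range (Fintype.card Λ), ((sawWords d n).card : ℝ) * (besselI 1 K / besselI 0 K) ^ n := by
        refine Finset.sum_le_sum fun n _ => mul_le_mul_of_nonneg_right ?_ (pow_nonneg hu0 n)
        have hinj : ∀ y ∈ (Finset.univ : Finset Λ), ∀ z ∈ (Finset.univ : Finset Λ),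
            (fun x : Λ => (x : Site d) - (x₀ : Site d)) y = (fun x : Λ => (x : Site d) - (x₀ : Site d)) z → y = z :=
          fun y _ z _ h => Subtype.ext (sub_left_injective h)
        have h := sum_card_sawWordsTo_le (d := d) n (Finset.univ.image fun x : Λ => (x : Site d) - (x₀ : Site d))
        rw [Finset.sum_image hinj] at h
        exact_mod_cast h

/-- **The planar XY susceptibility below the SAW threshold, kernel-explicit**: for `K ≥ 0` with `u(K) ≤ u₀`,
`44100 u₀¹⁰ < 1`, every finite `Λ ⊂ ℤ²` and `x₀ ∈ Λ`:
`∑_{x ∈ Λ} ⟨cos(θ_{x₀} − θ_x)⟩_Λ ≤ F(u₀) := S₁₀(u₀)/(1 − 44100 u₀¹⁰)` (tree census `c₁…c₁₀(ℤ²)`,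
`sum_card_sawWords_two_mul_pow_le`). No Ising model and no Aizenman–Simon step enter.
[cite: Fisher1967, Phys. Rev. 162 (1967) 480 (T_c bounds from self-avoiding walks); MadrasSlade1993, Appendix C Table C.1 (d = 2)] -/
theorem sum_twoPoint_nn_two_le_sawSeries {K : ℝ} (hK : 0 ≤ K) {u₀ : ℝ} (hu : besselI 1 K / besselI 0 K ≤ u₀)
    (hρ : 44100 * u₀ ^ 10 < 1) (Λ : Finset (Site 2)) (x₀ : Λ) :
    ∑ x : Λ, twoPoint (nnXYCoupling K 2 Λ) x₀ x ≤
      (1 + 4 * u₀ + 12 * u₀ ^ 2 + 36 * u₀ ^ 3 + 100 * u₀ ^ 4 + 284 * u₀ ^ 5 + 780 * u₀ ^ 6 + 2172 * u₀ ^ 7 +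
        5916 * u₀ ^ 8 + 16268 * u₀ ^ 9) / (1 - 44100 * u₀ ^ 10) := by
  have hu0 : 0 ≤ besselI 1 K / besselI 0 K := div_nonneg (besselI_nonneg hK 1) (besselI_nonneg hK 0)
  have hu₀ : 0 ≤ u₀ := hu0.trans hu
  refine (sum_twoPoint_nn_le_sawSum_besselRatio hK Λ x₀).trans ?_
  refine le_trans (Finset.sum_le_sum fun n _ => mul_le_mul_of_nonneg_left (pow_le_pow_left₀ hu0 hu n)
    (Nat.cast_nonneg _)) ?_
  exact sum_card_sawWords_two_mul_pow_le hu₀ hρ _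

/-! ### §3 The layered XY model: in-plane susceptibility and layer decoupling with `u(βJ∥)` -/

section Layered

open Literature.Barriers.CriticalPhenomena Literature.Barriers.CriticalPhenomena.LongRangeIsing

/-- **In-plane susceptibility of the layered XY model from the planar XY model** (Griffiths–Ginibre comparison of
the in-plane system of one layer with the two-dimensional nearest-neighbour model on the projected layer, as in
`sum_twoPoint_inPlane_le_tsum_infTwoPoint`, then §2): for `β, J∥ ≥ 0`, `J⊥ ≥ 0`, `u(βJ∥) ≤ u₀`,
`44100 u₀¹⁰ < 1`, every finite `Λ ⊂ ℤ³` and `a ∈ Λ`, `∑_{x ∈ Λ_{ℓ(a)}} ⟨cos(θ_a − θ_x)⟩^{2D}_{Λ_{ℓ(a)}} ≤ F(u₀)`.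
[cite: Ginibre1970, Prop. 3 with Example 4 (plane rotators); Fisher1967, Phys. Rev. 162 (1967) 480 (T_c bounds from self-avoiding walks)] -/
theorem sum_twoPoint_inPlane_le_sawSeries_besselRatio {β Jp Jz : ℝ} (hβ : 0 ≤ β) (hp : 0 ≤ Jp) (hz : 0 ≤ Jz)
    (Λ : Finset (Site 3)) {u₀ : ℝ} (hu : besselI 1 (β * Jp) / besselI 0 (β * Jp) ≤ u₀)
    (hρ : 44100 * u₀ ^ 10 < 1) (a : Λ) :
    ∑ x ∈ univ.filter (fun x : Λ => layer x = layer a),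
        twoPoint (inPlane (layeredXYCoupling β Jp Jz Λ) (layer a)) a x ≤
      (1 + 4 * u₀ + 12 * u₀ ^ 2 + 36 * u₀ ^ 3 + 100 * u₀ ^ 4 + 284 * u₀ ^ 5 + 780 * u₀ ^ 6 + 2172 * u₀ ^ 7 +
        5916 * u₀ ^ 8 + 16268 * u₀ ^ 9) / (1 - 44100 * u₀ ^ 10) := by
  classical
  have hK : 0 ≤ β * Jp := mul_nonneg hβ hp
  set Λ₂ : Finset (Site 2) := Λ.image planeProj with hΛ₂
  have hmem : ∀ y : Λ, planeProj (y : Site 3) ∈ Λ₂ := fun y => Finset.mem_image_of_mem _ y.2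
  let τ : Λ → Λ₂ := fun y => ⟨planeProj (y : Site 3), hmem y⟩
  set J := inPlane (layeredXYCoupling β Jp Jz Λ) (layer a) with hJ
  set A : Finset Λ := univ.filter (fun x : Λ => layer x = layer a) with hA
  have memA : ∀ x : Λ, x ∈ A ↔ (x : Site 3) 2 = (a : Site 3) 2 := fun x => by simp [hA, layer]
  have hJ0 : ∀ p, 0 ≤ J p := fun p => by
    simp only [hJ, inPlane]
    split_ifs
    · exact layeredXYCoupling_nonneg hβ hp hz Λ p
    · exact le_rfl
  have hJA : ∀ p, J p ≠ 0 → p.1 ∈ A ∧ p.2 ∈ A := by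
    intro p hp'
    simp only [hJ, inPlane] at hp'
    split_ifs at hp' with h
    · exact ⟨(memA p.1).2 h.1, (memA p.2).2 h.2⟩
    · exact absurd rfl hp'
  have hτ : Set.InjOn τ A := by
    intro y hy z hz hyz
    have h : planeProj (y : Site 3) = planeProj (z : Site 3) := congrArg Subtype.val hyz
    exact Subtype.ext (eq_of_layer_eq_of_planeProj_eq (((memA y).1 hy).trans ((memA z).1 hz).symm) h)
  have hK0 : ∀ q : Λ₂ × Λ₂, 0 ≤ nnXYCoupling (β * Jp) 2 Λ₂ q := fun q =>
    mul_nonneg (by positivity) (nnCoupling_nonneg _ _)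
  have hdom : ∀ y ∈ A, ∀ z ∈ A, J (y, z) ≤ nnXYCoupling (β * Jp) 2 Λ₂ (τ y, τ z) := by
    intro y hy z hz
    have hyz : (y : Site 3) 2 = (z : Site 3) 2 := ((memA y).1 hy).trans ((memA z).1 hz).symm
    have hy' : layer y = layer a := (memA y).1 hy
    have hz' : layer z = layer a := (memA z).1 hz
    simp only [hJ, inPlane, if_pos (And.intro hy' hz'), layeredXYCoupling, nnXYCoupling, LongRangeIsing.layeredCoupling,
      nnCoupling]
    rw [l1Norm_sub_eq_planeProj_of_layer_eq hyz]
    have h2 : ((y : Site 3) - (z : Site 3)) 2 = 0 := by simp [hyz]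
    simp only [h2, if_true]
    split_ifs <;> nlinarith
  calc ∑ x ∈ A, twoPoint J a x
      ≤ ∑ x ∈ A, twoPoint (nnXYCoupling (β * Jp) 2 Λ₂) (τ a) (τ x) :=
        Finset.sum_le_sum fun x hx => twoPoint_le_of_injOn hJ0 hJA τ hτ hK0 hdom ((memA a).2 rfl) hx
    _ = ∑ u ∈ A.image τ, twoPoint (nnXYCoupling (β * Jp) 2 Λ₂) (τ a) u := by
        rw [Finset.sum_image fun y hy z hz hyz => hτ hy hz hyz]
    _ ≤ ∑ u : Λ₂, twoPoint (nnXYCoupling (β * Jp) 2 Λ₂) (τ a) u :=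
        Finset.sum_le_sum_of_subset_of_nonneg (Finset.subset_univ _) fun u _ _ => twoPoint_nonneg hK0 _ _
    _ ≤ _ := sum_twoPoint_nn_two_le_sawSeries hK hu hρ Λ₂ (τ a)

/-- **Certificate-free layer decoupling of the classical layered XY model with the two-spin value** (Lieb–Rivasseau
decoupling `twoPoint_layered_le_pow_interlayer'` × Fisher's SAW bound for the rotator × the kernel census of `ℤ²`;
neither the Ising model nor the Aizenman–Simon comparison enters): for `β, J∥ ≥ 0`, `J⊥ ≥ 0`, `u(βJ∥) ≤ u₀`,
`44100 u₀¹⁰ < 1`, every finite `Λ ⊂ ℤ³` and all `a, c ∈ Λ`,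
`⟨cos(θ_a − θ_c)⟩_{Λ,β} ≤ (β J⊥ · S₁₀(u₀)/(1 − 44100 u₀¹⁰))^{|ℓ(a) − ℓ(c)|}`.
[cite: Lieb1980, eq. (23) and notes added in proof (2); Fisher1967, Phys. Rev. 162 (1967) 480 (T_c bounds from self-avoiding walks)] -/
theorem twoPoint_layered_le_pow_sawSeries_besselRatio {β Jp Jz : ℝ} (hβ : 0 ≤ β) (hp : 0 ≤ Jp) (hz : 0 ≤ Jz)
    (Λ : Finset (Site 3)) {u₀ : ℝ} (hu : besselI 1 (β * Jp) / besselI 0 (β * Jp) ≤ u₀) (hρ : 44100 * u₀ ^ 10 < 1)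
    (a c : Λ) :
    twoPoint (layeredXYCoupling β Jp Jz Λ) a c ≤
      (β * Jz * ((1 + 4 * u₀ + 12 * u₀ ^ 2 + 36 * u₀ ^ 3 + 100 * u₀ ^ 4 + 284 * u₀ ^ 5 + 780 * u₀ ^ 6 +
        2172 * u₀ ^ 7 + 5916 * u₀ ^ 8 + 16268 * u₀ ^ 9) / (1 - 44100 * u₀ ^ 10))) ^ (layer a - layer c).natAbs :=
  twoPoint_layered_le_pow_interlayer' hβ hp hz Λ
    (fun a' => sum_twoPoint_inPlane_le_sawSeries_besselRatio hβ hp hz Λ hu hρ a') a c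

/-- Monotone consumption form: if moreover `β J⊥ · F(u₀) ≤ r` then `⟨cos(θ_a − θ_c)⟩_{Λ,β} ≤ r^{|ℓ(a) − ℓ(c)|}`.
[cite: Lieb1980, eq. (23) and notes added in proof (2)] -/
theorem twoPoint_layered_le_pow_of_sawSeries_besselRatio_le {β Jp Jz : ℝ} (hβ : 0 ≤ β) (hp : 0 ≤ Jp)
    (hz : 0 ≤ Jz) (Λ : Finset (Site 3)) {u₀ : ℝ} (hu : besselI 1 (β * Jp) / besselI 0 (β * Jp) ≤ u₀)
    (hρ : 44100 * u₀ ^ 10 < 1) {r : ℝ}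
    (hr : β * Jz * ((1 + 4 * u₀ + 12 * u₀ ^ 2 + 36 * u₀ ^ 3 + 100 * u₀ ^ 4 + 284 * u₀ ^ 5 + 780 * u₀ ^ 6 +
        2172 * u₀ ^ 7 + 5916 * u₀ ^ 8 + 16268 * u₀ ^ 9) / (1 - 44100 * u₀ ^ 10)) ≤ r)
    (a c : Λ) :
    twoPoint (layeredXYCoupling β Jp Jz Λ) a c ≤ r ^ (layer a - layer c).natAbs := by
  have hu0 : 0 ≤ besselI 1 (β * Jp) / besselI 0 (β * Jp) :=
    div_nonneg (besselI_nonneg (mul_nonneg hβ hp) 1) (besselI_nonneg (mul_nonneg hβ hp) 0)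
  have hu₀ : 0 ≤ u₀ := hu0.trans hu
  refine (twoPoint_layered_le_pow_sawSeries_besselRatio hβ hp hz Λ hu hρ a c).trans (pow_le_pow_left₀ ?_ hr _)
  have hF : 0 ≤ (1 + 4 * u₀ + 12 * u₀ ^ 2 + 36 * u₀ ^ 3 + 100 * u₀ ^ 4 + 284 * u₀ ^ 5 + 780 * u₀ ^ 6 +
      2172 * u₀ ^ 7 + 5916 * u₀ ^ 8 + 16268 * u₀ ^ 9) / (1 - 44100 * u₀ ^ 10) :=
    div_nonneg (by positivity) (by linarith)
  exact mul_nonneg (mul_nonneg hβ hz) hF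

end Layered

/-! ### §4 Decimal rows (Amos' bound `u(x) ≤ x/√(x² + 4)`, exact rational arithmetic) -/

section Rows

open Literature.Barriers.CriticalPhenomena Literature.Barriers.CriticalPhenomena.LongRangeIsing

omit [MeasurableSpace Circle] [BorelSpace Circle] in
/-- `x/√(x² + 4) ≤ c` as soon as `x²(1 − c²) ≤ 4c²` (`x ≥ 0`, `c > 0`). [folklore] -/
private theorem div_sqrt_sq_add_four_le {x c : ℝ} (hx : 0 ≤ x) (hc : 0 < c) (h : x ^ 2 * (1 - c ^ 2) ≤ 4 * c ^ 2) :
    x / Real.sqrt (x ^ 2 + 4) ≤ c := by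
  have hs : 0 < Real.sqrt (x ^ 2 + 4) := Real.sqrt_pos.2 (by positivity)
  rw [div_le_iff₀ hs]
  calc x = Real.sqrt (x ^ 2) := (Real.sqrt_sq hx).symm
    _ ≤ Real.sqrt (c ^ 2 * (x ^ 2 + 4)) := Real.sqrt_le_sqrt (by nlinarith [h])
    _ = c * Real.sqrt (x ^ 2 + 4) := by rw [Real.sqrt_mul (sq_nonneg c), Real.sqrt_sq hc.le]

omit [MeasurableSpace Circle] [BorelSpace Circle] in
/-- The two-spin value below a rational: `u(x) ≤ c` from Amos' bound and `x²(1 − c²) ≤ 4c²` (`x, c > 0`).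
[cite: Amos1974, eq. (11) (m = 0)] -/
private theorem besselRatio_le_of_sq {x c : ℝ} (hx : 0 < x) (hc : 0 < c) (h : x ^ 2 * (1 - c ^ 2) ≤ 4 * c ^ 2) :
    besselI 1 x / besselI 0 x ≤ c :=
  (besselRatio_le hx).trans (div_sqrt_sq_add_four_le hx.le hc h)

variable {β Jp Jz : ℝ}

/-- **Row `k_BT = (π/2)·J∥` — the K4-a temperature** (`βJ∥ = 2/π`, `u(2/π) ≤ 0.30332` by Amos, `F(0.30332) ≤ 10.9905`):
**for every `J⊥ ≤ J∥/7`** the interlayer two-point function of the classical layered XY model decays like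
`(0.9996)^{|Δℓ|}` on every finite `Λ ⊂ ℤ³` — the certificate-free disordered edge of the comparison-model window
moves from `J∥/8` (Aizenman–Simon + Ising–Fisher, `twoPoint_layered_le_pow_at_pi_div_two`) to `J∥/7`.
[cite: Lieb1980, eq. (23) and notes added in proof (2); Fisher1967, Phys. Rev. 162 (1967) 480 (T_c bounds from self-avoiding walks); Amos1974, eq. (11)] -/
theorem twoPoint_layered_le_pow_besselRatio_at_pi_div_two (hβ : 0 < β) (hp : 0 < Jp) (hK : β * Jp = 2 / Real.pi)
    (hz0 : 0 ≤ Jz) (hz : Jz ≤ Jp / 7) (Λ : Finset (Site 3)) (a c : Λ) :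
    twoPoint (layeredXYCoupling β Jp Jz Λ) a c ≤ (9996 / 10000 : ℝ) ^ (layer a - layer c).natAbs := by
  have hπ := Real.pi_gt_d6
  have hx : 0 < 2 / Real.pi := by positivity
  have h9 : (3.141592 : ℝ) ^ 2 < Real.pi ^ 2 := pow_lt_pow_left₀ hπ (by norm_num) two_ne_zero
  have hu : besselI 1 (β * Jp) / besselI 0 (β * Jp) ≤ 30332 / 100000 := by
    rw [hK]
    have hc : (2 / Real.pi) ^ 2 * (1 - (30332 / 100000 : ℝ) ^ 2) ≤ 4 * (30332 / 100000 : ℝ) ^ 2 := by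
      -- `4/π² · (1 − c²) ≤ 4c²` ⟸ `π² ≥ (1 − c²)/c²`
      rw [div_pow, div_mul_eq_mul_div, div_le_iff₀ (by positivity)]
      nlinarith [h9]
    exact besselRatio_le_of_sq hx (by norm_num) hc
  refine twoPoint_layered_le_pow_of_sawSeries_besselRatio_le hβ.le hp.le hz0 Λ hu (by norm_num) ?_ a c
  have hβJz : β * Jz ≤ 2 / Real.pi / 7 := by
    have h1 := mul_le_mul_of_nonneg_left hz hβ.le
    have h2 : β * (Jp / 7) = (2 / Real.pi) / 7 := by rw [← hK]; ring
    linarith [h1, h2.le]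
  have hβJz' : β * Jz ≤ 9095 / 100000 := by
    refine hβJz.trans ?_
    rw [div_div, div_le_iff₀ (by positivity)]
    nlinarith [hπ]
  have hF : (0 : ℝ) ≤ (1 + 4 * (30332 / 100000 : ℝ) + 12 * (30332 / 100000) ^ 2 + 36 * (30332 / 100000) ^ 3 +
      100 * (30332 / 100000) ^ 4 + 284 * (30332 / 100000) ^ 5 + 780 * (30332 / 100000) ^ 6 +
      2172 * (30332 / 100000) ^ 7 + 5916 * (30332 / 100000) ^ 8 + 16268 * (30332 / 100000) ^ 9) /
      (1 - 44100 * (30332 / 100000) ^ 10) := by norm_num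
  calc β * Jz * _ ≤ 9095 / 100000 * _ := mul_le_mul_of_nonneg_right hβJz' hF
    _ ≤ 9996 / 10000 := by norm_num

/-- **Row `k_BT = (π/2)·J∥`, comfortable companion**: for every `J⊥ ≤ (7/50)·J∥` the interlayer two-point function
decays like `(0.98)^{|Δℓ|}` on every finite `Λ ⊂ ℤ³` (same inputs as the `J∥/7` row, margin `2·10⁻²` instead of
`4·10⁻⁴`). [cite: Lieb1980, eq. (23) and notes added in proof (2); Fisher1967, Phys. Rev. 162 (1967) 480 (T_c bounds from self-avoiding walks); Amos1974, eq. (11)] -/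
theorem twoPoint_layered_le_pow_besselRatio_at_pi_div_two' (hβ : 0 < β) (hp : 0 < Jp) (hK : β * Jp = 2 / Real.pi)
    (hz0 : 0 ≤ Jz) (hz : Jz ≤ 7 / 50 * Jp) (Λ : Finset (Site 3)) (a c : Λ) :
    twoPoint (layeredXYCoupling β Jp Jz Λ) a c ≤ (98 / 100 : ℝ) ^ (layer a - layer c).natAbs := by
  have hπ := Real.pi_gt_d6
  have hx : 0 < 2 / Real.pi := by positivity
  have h9 : (3.141592 : ℝ) ^ 2 < Real.pi ^ 2 := pow_lt_pow_left₀ hπ (by norm_num) two_ne_zero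
  have hu : besselI 1 (β * Jp) / besselI 0 (β * Jp) ≤ 30332 / 100000 := by
    rw [hK]
    have hc : (2 / Real.pi) ^ 2 * (1 - (30332 / 100000 : ℝ) ^ 2) ≤ 4 * (30332 / 100000 : ℝ) ^ 2 := by
      rw [div_pow, div_mul_eq_mul_div, div_le_iff₀ (by positivity)]
      nlinarith [h9]
    exact besselRatio_le_of_sq hx (by norm_num) hc
  refine twoPoint_layered_le_pow_of_sawSeries_besselRatio_le hβ.le hp.le hz0 Λ hu (by norm_num) ?_ a c
  have hβJz : β * Jz ≤ 7 / 50 * (2 / Real.pi) := by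
    have h1 := mul_le_mul_of_nonneg_left hz hβ.le
    have h2 : β * (7 / 50 * Jp) = 7 / 50 * (β * Jp) := by ring
    rw [h2, hK] at h1
    exact h1
  have hβJz' : β * Jz ≤ 8913 / 100000 := by
    refine hβJz.trans ?_
    rw [← mul_div_assoc, div_le_iff₀ Real.pi_pos]
    nlinarith [hπ]
  have hF : (0 : ℝ) ≤ (1 + 4 * (30332 / 100000 : ℝ) + 12 * (30332 / 100000) ^ 2 + 36 * (30332 / 100000) ^ 3 +
      100 * (30332 / 100000) ^ 4 + 284 * (30332 / 100000) ^ 5 + 780 * (30332 / 100000) ^ 6 +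
      2172 * (30332 / 100000) ^ 7 + 5916 * (30332 / 100000) ^ 8 + 16268 * (30332 / 100000) ^ 9) /
      (1 - 44100 * (30332 / 100000) ^ 10) := by norm_num
  calc β * Jz * _ ≤ 8913 / 100000 * _ := mul_le_mul_of_nonneg_right hβJz' hF
    _ ≤ 98 / 100 := by norm_num

/-- **Row `k_BT = 2J∥`** (`βJ∥ = 1/2`, `u(1/2) ≤ 0.2426`, `F(0.2426) ≤ 4.295`): for every `J⊥ ≤ (23/50)·J∥` the
interlayer two-point function decays like `(0.988)^{|Δℓ|}` (the tanh-route gave `9/20`).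
[cite: Lieb1980, eq. (23) and notes added in proof (2); Fisher1967, Phys. Rev. 162 (1967) 480 (T_c bounds from self-avoiding walks); Amos1974, eq. (11)] -/
theorem twoPoint_layered_le_pow_besselRatio_at_half (hβ : 0 < β) (hp : 0 < Jp) (hK : β * Jp = 1 / 2)
    (hz0 : 0 ≤ Jz) (hz : Jz ≤ 23 / 50 * Jp) (Λ : Finset (Site 3)) (a c : Λ) :
    twoPoint (layeredXYCoupling β Jp Jz Λ) a c ≤ (988 / 1000 : ℝ) ^ (layer a - layer c).natAbs := by
  have hu : besselI 1 (β * Jp) / besselI 0 (β * Jp) ≤ 2426 / 10000 := by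
    rw [hK]
    exact besselRatio_le_of_sq (by norm_num) (by norm_num) (by norm_num)
  refine twoPoint_layered_le_pow_of_sawSeries_besselRatio_le hβ.le hp.le hz0 Λ hu (by norm_num) ?_ a c
  have hβJz : β * Jz ≤ 23 / 100 := by
    have h1 := mul_le_mul_of_nonneg_left hz hβ.le
    have h2 : β * (23 / 50 * Jp) = 23 / 50 * (β * Jp) := by ring
    rw [h2, hK] at h1
    linarith
  have hF : (0 : ℝ) ≤ (1 + 4 * (2426 / 10000 : ℝ) + 12 * (2426 / 10000) ^ 2 + 36 * (2426 / 10000) ^ 3 +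
      100 * (2426 / 10000) ^ 4 + 284 * (2426 / 10000) ^ 5 + 780 * (2426 / 10000) ^ 6 + 2172 * (2426 / 10000) ^ 7 +
      5916 * (2426 / 10000) ^ 8 + 16268 * (2426 / 10000) ^ 9) / (1 - 44100 * (2426 / 10000) ^ 10) := by norm_num
  calc β * Jz * _ ≤ 23 / 100 * _ := mul_le_mul_of_nonneg_right hβJz hF
    _ ≤ 988 / 1000 := by norm_num

/-- **Row `k_BT = (5/3)J∥`** (`βJ∥ = 3/5`, `u(3/5) ≤ 0.2874`, `F(0.2874) ≤ 7.85`): for every `J⊥ ≤ (21/100)·J∥` the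
interlayer two-point function decays like `(0.99)^{|Δℓ|}` (the tanh-route gave `19/100`).
[cite: Lieb1980, eq. (23) and notes added in proof (2); Fisher1967, Phys. Rev. 162 (1967) 480 (T_c bounds from self-avoiding walks); Amos1974, eq. (11)] -/
theorem twoPoint_layered_le_pow_besselRatio_at_three_fifths (hβ : 0 < β) (hp : 0 < Jp) (hK : β * Jp = 3 / 5)
    (hz0 : 0 ≤ Jz) (hz : Jz ≤ 21 / 100 * Jp) (Λ : Finset (Site 3)) (a c : Λ) :
    twoPoint (layeredXYCoupling β Jp Jz Λ) a c ≤ (99 / 100 : ℝ) ^ (layer a - layer c).natAbs := by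
  have hu : besselI 1 (β * Jp) / besselI 0 (β * Jp) ≤ 2874 / 10000 := by
    rw [hK]
    exact besselRatio_le_of_sq (by norm_num) (by norm_num) (by norm_num)
  refine twoPoint_layered_le_pow_of_sawSeries_besselRatio_le hβ.le hp.le hz0 Λ hu (by norm_num) ?_ a c
  have hβJz : β * Jz ≤ 63 / 500 := by
    have h1 := mul_le_mul_of_nonneg_left hz hβ.le
    have h2 : β * (21 / 100 * Jp) = 21 / 100 * (β * Jp) := by ring
    rw [h2, hK] at h1
    linarith
  have hF : (0 : ℝ) ≤ (1 + 4 * (2874 / 10000 : ℝ) + 12 * (2874 / 10000) ^ 2 + 36 * (2874 / 10000) ^ 3 +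
      100 * (2874 / 10000) ^ 4 + 284 * (2874 / 10000) ^ 5 + 780 * (2874 / 10000) ^ 6 + 2172 * (2874 / 10000) ^ 7 +
      5916 * (2874 / 10000) ^ 8 + 16268 * (2874 / 10000) ^ 9) / (1 - 44100 * (2874 / 10000) ^ 10) := by norm_num
  calc β * Jz * _ ≤ 63 / 500 * _ := mul_le_mul_of_nonneg_right hβJz hF
    _ ≤ 99 / 100 := by norm_num

/-- **Row `k_BT = J∥/log 2 = 1.4427·J∥`** (`βJ∥ = log 2`, `u(log 2) ≤ 0.3275`, `F(0.3275) ≤ 27.84`): for every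
`J⊥ ≤ J∥/20` the interlayer two-point function decays like `(0.97)^{|Δℓ|}` (the tanh-route gave `J∥/32`).
[cite: Lieb1980, eq. (23) and notes added in proof (2); Fisher1967, Phys. Rev. 162 (1967) 480 (T_c bounds from self-avoiding walks); Amos1974, eq. (11)] -/
theorem twoPoint_layered_le_pow_besselRatio_at_log_two (hβ : 0 < β) (hp : 0 < Jp) (hK : β * Jp = Real.log 2)
    (hz0 : 0 ≤ Jz) (hz : Jz ≤ Jp / 20) (Λ : Finset (Site 3)) (a c : Λ) :
    twoPoint (layeredXYCoupling β Jp Jz Λ) a c ≤ (97 / 100 : ℝ) ^ (layer a - layer c).natAbs := by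
  have hl1 := Real.log_two_lt_d9
  have hl2 := Real.log_two_gt_d9
  have hu : besselI 1 (β * Jp) / besselI 0 (β * Jp) ≤ 3275 / 10000 := by
    rw [hK]
    refine besselRatio_le_of_sq (by linarith) (by norm_num) ?_
    nlinarith [hl1, hl2]
  refine twoPoint_layered_le_pow_of_sawSeries_besselRatio_le hβ.le hp.le hz0 Λ hu (by norm_num) ?_ a c
  have hβJz : β * Jz ≤ 3465736 / 100000000 := by
    have h1 := mul_le_mul_of_nonneg_left hz hβ.le
    have h2 : β * (Jp / 20) = (β * Jp) / 20 := by ring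
    rw [h2, hK] at h1
    linarith
  have hF : (0 : ℝ) ≤ (1 + 4 * (3275 / 10000 : ℝ) + 12 * (3275 / 10000) ^ 2 + 36 * (3275 / 10000) ^ 3 +
      100 * (3275 / 10000) ^ 4 + 284 * (3275 / 10000) ^ 5 + 780 * (3275 / 10000) ^ 6 + 2172 * (3275 / 10000) ^ 7 +
      5916 * (3275 / 10000) ^ 8 + 16268 * (3275 / 10000) ^ 9) / (1 - 44100 * (3275 / 10000) ^ 10) := by norm_num
  calc β * Jz * _ ≤ 3465736 / 100000000 * _ := mul_le_mul_of_nonneg_right hβJz hF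
    _ ≤ 97 / 100 := by norm_num

end Rows

end PlaneRotator

end Literature.Probability.LatticeModels

end
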